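/-
Copyright (c) 2026 the pub-hodgecm-mathlib formalisation cell (harness21).  Prover seat hodgecm-mathlib-K2E3-p29 (g0), HCML Track B «K2-LIT» (build stream 29),
h413 = `stmt-HodgeConjecture-24833`, line `K2_E3_EllipticInputs`, unit U12 «Characters», PART «SC» leaf (SC-an)₂ (road «FC₂», CLOSE-OUT DAY strike line L4 `stub_StCharTS`,
LINE-LEAD K2E3-plan (g4), deal D135 sequel «(ε)₂ RE-THREAD» FILE 2 OF 3 «(ε-Cayley₂)»): local `∫⁻`-finiteness of `(‖disc χ_g‖·‖det g‖⁻¹)^{−r}` on a unitary group IN TWO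
VARIABLES follows from that of `‖disc χ_X‖^{−r}` on its Lie algebra, every real `r ≥ 0` — the exponent-parametric twin of ★ K2E3-p27's (HCD₂ FILE 2b)
`K2E3U11WeylDiscrGroupToLie` (the case `r = 1∕4`) and the `2 × 2` twin of ★ (ε5) `K2E3HCDGroupToLieRpow` (K2E3-p21).  2026-09-04.
-/
import Summits.HodgeConjecture.HodgeConjecture.Theorems.K2E3U11WeylDiscrGroupToLie   -- ★ (HCD₂ FILE 2b) (K2E3-p27): `continuous_discr_charpoly_fin_two`; brings ★ FILE 2a `weylRatio_smul_fin_two`, `weylRatio_cayley_mul_fin_two`, ★ `F0P3cStCharTSHCDCayleyChartAt` (`exists_depth_lintegral_translate_eq`, `isClosedEmbedding_subtype`, `cayley`)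
import Mathlib.Analysis.SpecialFunctions.Pow.Continuity
import HarnessLib

/-!
# h413 ∕ Track B «K2-LIT», (SC-an)₂ ∕ (M5h)₂ — «(ε)₂ RE-THREAD» FILE 2 «(ε-Cayley₂)»: THE GROUP → LIE-ALGEBRA STEP AT A REAL EXPONENT `r`, TWO VARIABLES
# (`(‖disc χ_g‖·‖det g‖⁻¹)^{−r}` locally integrable on `U(σ, J)(K) ≤ GL₂(K)` from `‖disc χ_X‖^{−r}` locally integrable on `𝔲 = {ᵗ(σX)J + JX = 0}`; translated Cayley chart)

Cell `pub/hodgecm-mathlib`, crux H413 = `stmt-HodgeConjecture-24833` (lane `--supports … --as helper`, count-neutral); seat K2E3-p29 (g0); LINE-LEAD ∕ dealer K2E3-plan (g4)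
(deal D135 + this seat's R0 census 2026-09-04T14:55:02Z: the «(ε)₂ re-thread» discharging the (ε6)₂ letter of ★ p861141 `K2E3SupercuspidalTruncatedCharWeightKitTwo` §4).
THEOREMS ONLY; sorry-free; no `def` ∕ `instance` ∕ `notation` ∕ named-fact hypothesis.

THE TWO TOKENS (rank one; SUB-LINE CONVENTION of ★ (ε5) copied: the exponent is the real `r` on the `normAbs K`-token in the shape `((↑x : ℝ≥0∞)) ^ (-r)`):
**`θᵣ M := (↑(‖disc χ_M‖ · ‖det M‖⁻¹))^(−r)`** (the `2 × 2` Weyl ratio has `det`-exponent `1 = n − 1`, which makes it invariant under scalars — ★ `weylRatio_smul_fin_two`) and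
**`ηᵣ X := (↑‖disc χ_X‖)^(−r)`**; ★ (HCD₂ FILE 2b)'s `θ₂ = (↑√√(…))⁻¹`, `ηι = (↑√√‖disc‖)⁻¹` are the case `r = 1∕4` (★ (ε5) `coe_rpow_neg_quarter`).  On a unitary group
`‖det g‖ = 1`, so `θᵣ` agrees there with the `det⁻²`-shaped token of ★ `K2E3SupercuspidalTruncatedCharWeightKitTwo` (the conversion is FILE 3's business).

THE MATHEMATICS ([HarishChandra1970] Part VII §1 Thm. 15 — `|D_G|^{−1∕2−ε}` is locally summable — reduced to the Lie algebra as in loc. cit. §7; verbatim ★ (ε5) at `2 × 2`).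
§1 From `u · p = t² · a` (★ `weylRatio_cayley_mul_fin_two`: `u` the Weyl ratio of `z • c(X)`, `p = ‖det(1−X)det(1+X)‖`, `t = ‖2‖`, `a = ‖disc χ_X‖`), for EVERY real `r`,
**`(↑u)^(−r) = (↑(p∕t²))^r · (↑a)^(−r)`** in `[0, ∞]` (`coe_rpow_neg_eq_of_mul_eq`), whence §2 **`θᵣ(z • c X) = C(X)^r · ηᵣ(X)`**, `C(X) = ‖det(1−X)det(1+X)‖ ∕ ‖2‖²`.
§3 The `ℝ≥0`-valued Weyl ratio `g ↦ ‖disc χ_{ρg}‖·‖det ρg‖⁻¹` is continuous on `G` and `s ↦ (Weyl ratio)(z • c(X₀ + s))` is Borel on `𝔲` (continuous where `1 ± (X₀+s)` are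
invertible, `0` elsewhere) — exponent-free statements from which continuity ∕ measurability of `θᵣ` follow for every `r`.  §4 HEAD **`exists_nhds_setLIntegral_theta_rpow_lt_top`**
(`0 ≤ r`): if every point of `𝔲` has a neighbourhood on which `ηᵣ` is `μ`-integrable, then every `g₀ ∈ G` has a neighbourhood on which `θᵣ ∘ ρ` is `ν`-integrable — word for word
the ★ proofs: ★ `exists_depth_lintegral_translate_eq` (`∫_U θᵣ(ρ g) dν = κ ∫_{Λ_k} θᵣ(z • c(X₀ + L̃ Y)) dμ`), §2, `C ≤ C*` on the compact `Λ_k` and monotonicity of `x ↦ x^r`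
(`0 ≤ r`), the change of variables `Y ↦ X₀ + L̃ Y`, after shrinking `Λ_k` into the given neighbourhood of `X₀`.  The `hLie` letter at `2r < 1` is ★∕📤 FILE 1 «(ε-Lie₂)»
`K2E3U11WeylDiscrLieLocIntRpow.forall_exists_nhds_setLIntegral_eta_rpow_lt_top_lie_two`.
HONEST LABEL: count-neutral; closes no socket; HC_CM is proved only modulo the 7 printed citations (2 remaining named inputs: hLiu418 = `stmt-HodgeConjecture-24832`,
h413 = `stmt-HodgeConjecture-24833`) until rung 0 closes; (SC-an)₂ is NOT ★.

## References
* [HarishChandra1970] Harish-Chandra, *Harmonic analysis on reductive p-adic groups*, LNM 162 (1970), Part VII §1 Thm. 15, §7.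
* [Rogawski1990] J. D. Rogawski, *Automorphic Representations of Unitary Groups in Three Variables* (1990), §4.9 p. 54 (`D_G`), §12.5 p. 182.
* [PlatonovRapinchuk1994] V. Platonov, A. Rapinchuk, *Algebraic Groups and Number Theory* (1994), §3.3 (the Cayley transform).
-/

set_option autoImplicit false
set_option linter.dupNamespace false

noncomputable section

open Set Filter MeasureTheory MeasureTheory.Measure TopologicalSpace Topology Matrix ValuativeRel Metric Polynomial
open Literature.NumberTheory.Automorphic Literature.NumberTheory.Weil1982.UnitaryFinTopForm Literature.LinearAlgebra.Matrix
open Literature.NumberTheory.GaloisRepresentations.IsNonarchimedeanLocalField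
open Summit.HodgeConjecture.HodgeConjecture.Cruxes.H413.F0P3cStCharTSHCDCayleyChartAt
open Summit.HodgeConjecture.HodgeConjecture.Cruxes.H413.K2E3U11WeylDiscrCayleyAlgebra
open Summit.HodgeConjecture.HodgeConjecture.Cruxes.H413.K2E3U11WeylDiscrGroupToLie (continuous_discr_charpoly_fin_two)
open scoped Pointwise Topology ENNReal NNReal MatrixGroups

namespace Summit.HodgeConjecture.HodgeConjecture.Cruxes.H413.K2E3U11WeylDiscrGroupToLieRpow

/-! ## §1 `ℝ≥0∞` `rpow` bookkeeping -/

section Rpow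

/-- **`(↑u)^(−r) = (↑(p∕t²))^r · (↑a)^(−r)`** in `[0, ∞]`, for `u · p = t² · a` in `ℝ≥0` with `p, t ≠ 0`, and EVERY real `r` (`u = (t²∕p)·a`, `ENNReal.mul_rpow_of_ne_top`,
`x^(−r) = (x⁻¹)^r`) — the `2 × 2` twin of ★ (ε5) `coe_rpow_neg_eq_of_mul_sq_eq`. [cite: Rogawski1990, §4.9 p. 54] -/
theorem coe_rpow_neg_eq_of_mul_eq {u p t a : ℝ≥0} (h : u * p = t ^ 2 * a) (hp : p ≠ 0) (ht : t ≠ 0) (r : ℝ) :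
    ((u : ℝ≥0∞)) ^ (-r) = (((p / t ^ 2 : ℝ≥0)) : ℝ≥0∞) ^ r * ((a : ℝ≥0∞)) ^ (-r) := by
  have ht2 : t ^ 2 ≠ 0 := pow_ne_zero _ ht
  have hu : u = t ^ 2 / p * a := by
    rw [div_mul_eq_mul_div, eq_div_iff hp, h]
  rw [hu, ENNReal.coe_mul, ENNReal.mul_rpow_of_ne_top ENNReal.coe_ne_top ENNReal.coe_ne_top, ENNReal.rpow_neg (((t ^ 2 / p : ℝ≥0)) : ℝ≥0∞) r,
    ← ENNReal.inv_rpow, ← ENNReal.coe_inv (div_ne_zero ht2 hp), inv_div]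

end Rpow

/-! ## §2 `θᵣ(z • c X) = C(X)^r · ηᵣ(X)` (`2 × 2`) -/

section Field

variable {K : Type*} [Field K] [ValuativeRel K] [TopologicalSpace K] [IsNonarchimedeanLocalField K]

/-- **`θᵣ(z • c X) = C(X)^r · ηᵣ(X)`**, two variables: for `z ≠ 0`, `1 ± X` invertible and `2 ≠ 0`,
`(↑(‖disc χ_M‖·‖det M‖⁻¹))^(−r) = (↑(‖det(1−X)det(1+X)‖ ∕ ‖2‖²))^r · (↑‖disc χ_X‖)^(−r)` with `M = z • c(X)`, for every real `r`
(★ `weylRatio_smul_fin_two`, ★ `weylRatio_cayley_mul_fin_two`, §1). [cite: Rogawski1990, §4.9 p. 54] [cite: PlatonovRapinchuk1994, §3.3] -/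
theorem weylRatio_rpow_neg_smul_cayley_eq (h2 : (2 : K) ≠ 0) {z : K} (hz : z ≠ 0) {X : Matrix (Fin 2) (Fin 2) K} (hm : IsUnit (1 - X).det)
    (hp : IsUnit (1 + X).det) (r : ℝ) :
    (((normAbs K (z • cayley X).charpoly.discr * (normAbs K (z • cayley X).det)⁻¹ : ℝ≥0) : ℝ≥0∞)) ^ (-r) =
      (((normAbs K ((1 - X).det * (1 + X).det) / (normAbs K 2) ^ 2 : ℝ≥0) : ℝ≥0∞)) ^ r *
        ((normAbs K X.charpoly.discr : ℝ≥0∞)) ^ (-r) := by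
  rw [weylRatio_smul_fin_two hz]
  exact coe_rpow_neg_eq_of_mul_eq (weylRatio_cayley_mul_fin_two hm hp) ((map_ne_zero (normAbs K)).2 (mul_ne_zero hm.ne_zero hp.ne_zero))
    ((map_ne_zero (normAbs K)).2 h2) r

end Field

/-! ## §3 Continuity ∕ measurability (exponent-free statements about the `ℝ≥0`-valued Weyl ratio, then `θᵣ` for every `r`) -/

section Measurable

variable {K : Type*} [Field K] [ValuativeRel K] [TopologicalSpace K] [IsNonarchimedeanLocalField K]

/-- At a singular `2 × 2` matrix the Weyl ratio `‖disc χ_M‖·‖det M‖⁻¹` is `0` (`0⁻¹ = 0` in `ℝ≥0`). [cite: Rogawski1990, §4.9 p. 54] -/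
theorem weylRatio_eq_zero_of_det_eq_zero {M : Matrix (Fin 2) (Fin 2) K} (hM : M.det = 0) :
    normAbs K M.charpoly.discr * (normAbs K M.det)⁻¹ = 0 := by
  rw [hM, map_zero, _root_.inv_zero, mul_zero]

/-- **The `ℝ≥0`-valued `2 × 2` Weyl ratio is continuous at matrices with non-zero determinant** (★ `continuous_discr_charpoly_fin_two`, ★ `continuous_normAbs`, `x ↦ x⁻¹`
continuous on `ℝ≥0` away from `0`). [cite: Rogawski1990, §4.9 p. 54] -/
theorem continuousAt_weylRatio {M : Matrix (Fin 2) (Fin 2) K} (hM : M.det ≠ 0) :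
    ContinuousAt (fun M : Matrix (Fin 2) (Fin 2) K => normAbs K M.charpoly.discr * (normAbs K M.det)⁻¹) M := by
  have h1 : Continuous fun M : Matrix (Fin 2) (Fin 2) K => normAbs K M.charpoly.discr :=
    LocalFieldHaar.continuous_normAbs.comp continuous_discr_charpoly_fin_two
  have h2 : Continuous fun M : Matrix (Fin 2) (Fin 2) K => normAbs K M.det := LocalFieldHaar.continuous_normAbs.comp continuous_id.matrix_det
  exact h1.continuousAt.mul (h2.continuousAt.inv₀ ((map_ne_zero (normAbs K)).2 hM))

/-- **`θᵣ` is continuous at `2 × 2` matrices with non-zero determinant**, for every real `r` (`ENNReal.continuous_rpow_const`). [cite: Rogawski1990, §4.9 p. 54] -/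
theorem continuousAt_theta_rpow {M : Matrix (Fin 2) (Fin 2) K} (hM : M.det ≠ 0) (r : ℝ) :
    ContinuousAt (fun M : Matrix (Fin 2) (Fin 2) K =>
      (((normAbs K M.charpoly.discr * (normAbs K M.det)⁻¹ : ℝ≥0) : ℝ≥0∞)) ^ (-r)) M :=
  ContinuousAt.comp (f := fun M : Matrix (Fin 2) (Fin 2) K => (((normAbs K M.charpoly.discr * (normAbs K M.det)⁻¹ : ℝ≥0) : ℝ≥0∞)))
    (x := M) ENNReal.continuous_rpow_const.continuousAt (ENNReal.continuous_coe.continuousAt.comp (continuousAt_weylRatio hM))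

variable {G : Type*} [Group G] [TopologicalSpace G] (ρ : G →* GL (Fin 2) K)

/-- **`g ↦ ‖disc χ_{ρ g}‖·‖det ρ g‖⁻¹` is continuous on `G`** for `ρ : G →* GL₂(K)` continuous (`det ρ g ≠ 0`). [cite: HarishChandra1970, Part VII §1 Thm. 15] -/
theorem continuous_weylRatio_comp (hρc : Continuous ρ) :
    Continuous fun g : G => normAbs K ((ρ g : GL (Fin 2) K) : Matrix (Fin 2) (Fin 2) K).charpoly.discr *
        (normAbs K ((ρ g : GL (Fin 2) K) : Matrix (Fin 2) (Fin 2) K).det)⁻¹ := by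
  have hM : Continuous fun g : G => ((ρ g : GL (Fin 2) K) : Matrix (Fin 2) (Fin 2) K) := Units.continuous_val.comp hρc
  rw [continuous_iff_continuousAt]
  intro g
  have hdet : ((ρ g : GL (Fin 2) K) : Matrix (Fin 2) (Fin 2) K).det ≠ 0 := by
    have h := (Matrix.GeneralLinearGroup.det (ρ g)).ne_zero
    rwa [Matrix.GeneralLinearGroup.val_det_apply] at h
  exact ContinuousAt.comp (f := fun g : G => ((ρ g : GL (Fin 2) K) : Matrix (Fin 2) (Fin 2) K)) (x := g) (continuousAt_weylRatio hdet)
    hM.continuousAt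

/-- **`g ↦ θᵣ(ρ g)` is continuous** (hence Borel) on `G` for `ρ : G →* GL₂(K)` continuous, every real `r`. [cite: HarishChandra1970, Part VII §1 Thm. 15] -/
theorem continuous_theta_rpow_comp (hρc : Continuous ρ) (r : ℝ) :
    Continuous fun g : G =>
      (((normAbs K ((ρ g : GL (Fin 2) K) : Matrix (Fin 2) (Fin 2) K).charpoly.discr *
        (normAbs K ((ρ g : GL (Fin 2) K) : Matrix (Fin 2) (Fin 2) K).det)⁻¹ : ℝ≥0) : ℝ≥0∞)) ^ (-r) :=
  ENNReal.continuous_rpow_const.comp (ENNReal.continuous_coe.comp (continuous_weylRatio_comp ρ hρc))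

variable (𝔲 : AddSubgroup (Matrix (Fin 2) (Fin 2) K)) [MeasurableSpace 𝔲] [BorelSpace 𝔲]

/-- **`s ↦ (‖disc χ_M‖·‖det M‖⁻¹)(z • c(X₀ + s))` is Borel on `𝔲`** (`ℝ≥0`-valued, `2 × 2`): continuous on the open set where `1 ± (X₀ + s)` are invertible (`c = (1 + ·)(1 − ·)⁻¹`,
matrix inversion is continuous at invertible matrices), identically `0` off it (there `c(X₀ + s)` is singular or junk `0`, so `det = 0`); Mathlib `ContinuousOn.measurable_piecewise`
(the ★ (ε5) argument at `2 × 2`). [cite: PlatonovRapinchuk1994, §3.3] [cite: Rogawski1990, §4.9 p. 54] -/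
theorem measurable_weylRatio_smul_cayley {z : K} (hz : z ≠ 0) (X₀ : Matrix (Fin 2) (Fin 2) K) :
    Measurable fun s : 𝔲 => normAbs K (z • cayley (X₀ + (s : Matrix (Fin 2) (Fin 2) K))).charpoly.discr *
        (normAbs K (z • cayley (X₀ + (s : Matrix (Fin 2) (Fin 2) K))).det)⁻¹ := by
  classical
  haveI : T2Space K := (isLocalField K).toT2Space
  set w : Matrix (Fin 2) (Fin 2) K → ℝ≥0 := fun M => normAbs K M.charpoly.discr * (normAbs K M.det)⁻¹ with hw
  set ψ : 𝔲 → Matrix (Fin 2) (Fin 2) K := fun s => z • cayley (X₀ + (s : Matrix (Fin 2) (Fin 2) K)) with hψ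
  set O : Set 𝔲 := {s | (1 - (X₀ + (s : Matrix (Fin 2) (Fin 2) K))).det ≠ 0 ∧ (1 + (X₀ + (s : Matrix (Fin 2) (Fin 2) K))).det ≠ 0} with hO
  have hco : Continuous fun s : 𝔲 => X₀ + (s : Matrix (Fin 2) (Fin 2) K) := continuous_const.add continuous_subtype_val
  have hOo : IsOpen O :=
    (isOpen_ne_fun ((continuous_const.sub hco).matrix_det) continuous_const).inter
      (isOpen_ne_fun ((continuous_const.add hco).matrix_det) continuous_const)
  -- off `O` the value is `0`
  have hoff : ∀ s, s ∉ O → w (ψ s) = 0 := by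
    intro s hs
    apply weylRatio_eq_zero_of_det_eq_zero
    simp only [hψ, Matrix.det_smul, cayley_def, Matrix.det_mul, Matrix.det_nonsing_inv, Ring.inverse_eq_inv']
    rw [hO, Set.mem_setOf_eq, not_and_or, not_ne_iff, not_ne_iff] at hs
    rcases hs with h | h
    · rw [h, _root_.inv_zero, mul_zero, mul_zero]
    · rw [h, zero_mul, mul_zero]
  -- on `O` the map is continuous
  have hon : ContinuousOn (fun s => w (ψ s)) O := by
    intro s hs
    have hdet1 : IsUnit (1 - (X₀ + (s : Matrix (Fin 2) (Fin 2) K))).det := isUnit_iff_ne_zero.2 hs.1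
    have hψc : ContinuousAt ψ s := by
      have hinv : ContinuousAt Inv.inv (1 - (X₀ + (s : Matrix (Fin 2) (Fin 2) K))) := by
        refine continuousAt_matrix_inv _ ?_
        rw [Ring.inverse_eq_inv']
        exact continuousAt_inv₀ hdet1.ne_zero
      have h1 : ContinuousAt (fun s : 𝔲 => (1 - (X₀ + (s : Matrix (Fin 2) (Fin 2) K)))⁻¹) s :=
        ContinuousAt.comp (f := fun s : 𝔲 => 1 - (X₀ + (s : Matrix (Fin 2) (Fin 2) K))) (x := s) hinv (continuous_const.sub hco).continuousAt
      have h2 : ContinuousAt (fun s : 𝔲 => (1 + (X₀ + (s : Matrix (Fin 2) (Fin 2) K))) * (1 - (X₀ + (s : Matrix (Fin 2) (Fin 2) K)))⁻¹) s :=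
        (continuous_const.add hco).continuousAt.mul h1
      have h3 : ContinuousAt (fun s : 𝔲 => z • ((1 + (X₀ + (s : Matrix (Fin 2) (Fin 2) K))) * (1 - (X₀ + (s : Matrix (Fin 2) (Fin 2) K)))⁻¹)) s :=
        ContinuousAt.comp (f := fun s : 𝔲 => (1 + (X₀ + (s : Matrix (Fin 2) (Fin 2) K))) * (1 - (X₀ + (s : Matrix (Fin 2) (Fin 2) K)))⁻¹) (x := s)
          (continuous_const_smul z).continuousAt h2
      simpa only [hψ, cayley_def] using h3
    have hdetψ : (ψ s).det ≠ 0 := by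
      simp only [hψ, Matrix.det_smul, cayley_def, Matrix.det_mul, Matrix.det_nonsing_inv, Ring.inverse_eq_inv']
      exact mul_ne_zero (pow_ne_zero _ hz) (mul_ne_zero hs.2 (inv_ne_zero hs.1))
    exact (ContinuousAt.comp (f := ψ) (x := s) (continuousAt_weylRatio hdetψ) hψc).continuousWithinAt
  have heq : (fun s => w (ψ s)) = O.piecewise (fun s => w (ψ s)) (fun _ => 0) := by
    funext s
    by_cases hs : s ∈ O
    · rw [Set.piecewise_eq_of_mem _ _ _ hs]
    · rw [Set.piecewise_eq_of_notMem _ _ _ hs, hoff s hs]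
  show Measurable fun s => w (ψ s)
  rw [heq]
  exact ContinuousOn.measurable_piecewise hon continuousOn_const hOo.measurableSet

/-- **`s ↦ θᵣ(z • c(X₀ + s))` is Borel on `𝔲`**, for every real `r` (`2 × 2`). [cite: PlatonovRapinchuk1994, §3.3] [cite: Rogawski1990, §4.9 p. 54] -/
theorem measurable_theta_rpow_smul_cayley {z : K} (hz : z ≠ 0) (X₀ : Matrix (Fin 2) (Fin 2) K) (r : ℝ) :
    Measurable fun s : 𝔲 =>
      (((normAbs K (z • cayley (X₀ + (s : Matrix (Fin 2) (Fin 2) K))).charpoly.discr *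
        (normAbs K (z • cayley (X₀ + (s : Matrix (Fin 2) (Fin 2) K))).det)⁻¹ : ℝ≥0) : ℝ≥0∞)) ^ (-r) :=
  ENNReal.continuous_rpow_const.measurable.comp (measurable_coe_nnreal_ennreal.comp (measurable_weylRatio_smul_cayley 𝔲 hz X₀))

end Measurable

/-! ## §4 HEAD: local integrability at exponent `r` transfers from the Lie algebra to the group (`2 × 2`) -/

section Head

variable {K : Type*} [Field K] [ValuativeRel K] [TopologicalSpace K] [IsNonarchimedeanLocalField K]
  (σ : K →+* K) (J : Matrix (Fin 2) (Fin 2) K) (𝔲 : AddSubgroup (Matrix (Fin 2) (Fin 2) K))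
  [MeasurableSpace 𝔲] [BorelSpace 𝔲] (μ : Measure 𝔲) [μ.IsAddHaarMeasure]
  {G : Type*} [Group G] [TopologicalSpace G] [IsTopologicalGroup G] [LocallyCompactSpace G] [SecondCountableTopology G] [T2Space G]
  [MeasurableSpace G] [BorelSpace G] (ρ : G →* GL (Fin 2) K) (ν : Measure G) [ν.IsHaarMeasure]

set_option maxHeartbeats 800000 in
-- the head threads ★ `exists_depth_lintegral_translate_eq` with the identity of §2 and one change of variables (the ★ (ε5) ∕ (HCD₂ FILE 2b) budget)
/-- **(ε-Cayley₂) HEAD — LOCAL INTEGRABILITY OF `(‖disc χ_g‖·‖det g‖⁻¹)^{−r}` FROM THE LIE ALGEBRA, TWO VARIABLES, every real `r ≥ 0`.**  In the setting of ★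
`exists_depth_lintegral_translate_eq` (`K` non-archimedean local, `2 ≠ 0`, `σ` continuous, `J` invertible, `𝔲 = {ᵗ(σX)J + JX = 0} ≤ M₂(K)` with additive Haar measure `μ`,
`ρ : G →* GL₂(K)` inducing injective onto the unitary group, Haar `ν`, infinitely many norm-one scalars): IF every point `X₀ ∈ 𝔲` has a neighbourhood `U` with
`∫⁻_U (↑‖disc χ_X‖)^(−r) dμ < ∞` (the token `ηᵣ`), THEN every `g₀ ∈ G` has a neighbourhood `U` with **`∫⁻_U (↑(‖disc χ_{ρ g}‖ · ‖det ρ g‖⁻¹))^(−r) dν(g) < ∞`** (the token `θᵣ`;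
`r = 1∕4` is ★ `K2E3U11WeylDiscrGroupToLie.exists_nhds_setLIntegral_theta_two_lt_top` by ★ `coe_rpow_neg_quarter`, `r = (1+δ)∕4` is what the (M5h)₂ kit consumes).  Proof: ★
(D6a)+(D6c) give `U = g₀ • c(Λ_k)` with `∫⁻_U θᵣ(ρ g) dν = κ ∫⁻_{Λ_k} θᵣ(z • c(X₀ + L̃ Y)) dμ`; §2 writes the integrand as `C(Y)^r · ηᵣ(X₀ + L̃ Y)` with `C ≤ C*` on the compact `Λ_k`
(`x ↦ x^r` monotone for `0 ≤ r`); `Y ↦ X₀ + L̃ Y` maps `μ` to `(addEquivAddHaarChar L̃)⁻¹ • μ`, and `Λ_k` was shrunk into the given neighbourhood of `X₀`.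
[cite: HarishChandra1970, Part VII §1 Thm. 15, §7] [cite: Rogawski1990, §12.5 p. 182] [cite: PlatonovRapinchuk1994, §3.3] -/
theorem exists_nhds_setLIntegral_theta_rpow_lt_top (hσc : Continuous σ) (h2 : (2 : K) ≠ 0) (hJ : IsUnit J.det)
    (h𝔲 : ∀ X, X ∈ 𝔲 ↔ (X.map σ)ᵀ * J + J * X = 0)
    (hρ : IsInducing ρ) (hρinj : Function.Injective ρ)
    (hρr : ∀ g : GL (Fin 2) K, g ∈ Set.range ρ ↔ (((g : Matrix (Fin 2) (Fin 2) K)).map σ)ᵀ * J * (g : Matrix (Fin 2) (Fin 2) K) = J)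
    (hE : {z : K | σ z * z = 1}.Infinite) {r : ℝ} (hr : 0 ≤ r)
    (hLie : ∀ X₀ : 𝔲, ∃ U ∈ 𝓝 X₀, ∫⁻ X in U,
      ((normAbs K (X : Matrix (Fin 2) (Fin 2) K).charpoly.discr : ℝ≥0∞)) ^ (-r) ∂μ < ∞)
    (g₀ : G) :
    ∃ U ∈ 𝓝 g₀, ∫⁻ g in U,
      (((normAbs K ((ρ g : GL (Fin 2) K) : Matrix (Fin 2) (Fin 2) K).charpoly.discr *
        (normAbs K ((ρ g : GL (Fin 2) K) : Matrix (Fin 2) (Fin 2) K).det)⁻¹ : ℝ≥0) : ℝ≥0∞)) ^ (-r) ∂ν < ∞ := by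
  classical
  -- instances on `𝔲` (closed in the locally compact, second countable, metrisable `M₂(K)`)
  haveI : T2Space K := (isLocalField K).toT2Space
  haveI : SecondCountableTopology K := secondCountableTopology_localField K
  haveI : TopologicalSpace.PseudoMetrizableSpace K := pseudoMetrizableSpace_localField K
  haveI : LocallyCompactSpace (Matrix (Fin 2) (Fin 2) K) := inferInstanceAs (LocallyCompactSpace (Fin 2 → Fin 2 → K))
  haveI : SecondCountableTopology (Matrix (Fin 2) (Fin 2) K) := inferInstanceAs (SecondCountableTopology (Fin 2 → Fin 2 → K))
  haveI : TopologicalSpace.PseudoMetrizableSpace (Matrix (Fin 2) (Fin 2) K) :=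
    inferInstanceAs (TopologicalSpace.PseudoMetrizableSpace (Fin 2 → Fin 2 → K))
  haveI : LocallyCompactSpace 𝔲 := (isClosedEmbedding_subtype σ J 𝔲 hσc h𝔲).locallyCompactSpace
  haveI : SecondCountableTopology 𝔲 := TopologicalSpace.Subtype.secondCountableTopology _
  haveI : SigmaCompactSpace 𝔲 := sigmaCompactSpace_of_locallyCompact_secondCountable
  haveI : μ.Regular := inferInstance
  -- the two integrands as functions
  set θ : Matrix (Fin 2) (Fin 2) K → ℝ≥0∞ := fun M =>
    (((normAbs K M.charpoly.discr * (normAbs K M.det)⁻¹ : ℝ≥0) : ℝ≥0∞)) ^ (-r) with hθ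
  set ηι : 𝔲 → ℝ≥0∞ := fun X => ((normAbs K (X : Matrix (Fin 2) (Fin 2) K).charpoly.discr : ℝ≥0∞)) ^ (-r) with hηι
  -- ★ (D6a)+(D6c)
  obtain ⟨z, X₀, LS, Λ, k₀, hz1, hz0, hX₀, hm, hp, hg₀, hLS, hΛo, hΛc, hΛanti, hΛbasis, hk⟩ :=
    exists_depth_lintegral_translate_eq σ J 𝔲 μ ρ ν hσc h2 hJ h𝔲 hρ hρinj hρr hE g₀
  -- the neighbourhood of `X₀` on the Lie side, an open part of it, and a depth inside it
  obtain ⟨UL, hUL, hint⟩ := hLie ⟨X₀, hX₀⟩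
  obtain ⟨V, hVU, hVo, hXV⟩ := mem_nhds_iff.1 hUL
  set T : 𝔲 → 𝔲 := fun Y => ⟨X₀, hX₀⟩ + LS Y with hT
  have hTc : Continuous T := continuous_const.add LS.continuous
  have hT0 : T 0 = ⟨X₀, hX₀⟩ := by rw [hT]; simp
  have hpre : T ⁻¹' V ∈ 𝓝 (0 : 𝔲) := hTc.continuousAt.preimage_mem_nhds (by rw [hT0]; exact hVo.mem_nhds hXV)
  obtain ⟨k₃, hk₃⟩ := hΛbasis _ hpre
  set k := max k₀ k₃ with hkdef
  obtain ⟨hgoodk, U, hUo, hg₀U, κ, hκ0, hκt, hId⟩ := hk k (le_max_left _ _)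
  have hΛkV : (Λ k : Set 𝔲) ⊆ T ⁻¹' V := fun Y hY => hk₃ (hΛanti (le_max_right _ _) hY)
  refine ⟨U, hUo.mem_nhds hg₀U, ?_⟩
  -- the identity of ★ (D6a)+(D6c) for `H := θᵣ`
  have hρc : Continuous ρ := hρ.continuous
  have hH₁ : Measurable fun g : G => θ ((ρ g : GL (Fin 2) K) : Matrix (Fin 2) (Fin 2) K) := (continuous_theta_rpow_comp ρ hρc r).measurable
  have hH₂ : Measurable fun s : 𝔲 => θ (z • cayley (X₀ + (s : Matrix (Fin 2) (Fin 2) K))) := measurable_theta_rpow_smul_cayley 𝔲 hz0 X₀ r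
  have hId' := hId θ hH₁ hH₂
  simp only [hθ] at hId' ⊢
  rw [hId']
  -- pointwise identity on `Λ k`: `θᵣ = C(Y)^r · ηᵣ (T Y)` with `C(Y) ≤ C*`
  have hcont : Continuous fun Y : 𝔲 =>
      normAbs K ((1 - (X₀ + ((LS Y : 𝔲) : Matrix (Fin 2) (Fin 2) K))).det * (1 + (X₀ + ((LS Y : 𝔲) : Matrix (Fin 2) (Fin 2) K))).det) := by
    have hc : Continuous fun Y : 𝔲 => X₀ + ((LS Y : 𝔲) : Matrix (Fin 2) (Fin 2) K) :=
      continuous_const.add (continuous_subtype_val.comp LS.continuous)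
    exact LocalFieldHaar.continuous_normAbs.comp (((continuous_const.sub hc).matrix_det).mul ((continuous_const.add hc).matrix_det))
  obtain ⟨B, hB⟩ := (hΛc k).bddAbove_image hcont.continuousOn
  set Cst : ℝ≥0∞ := (((B / (normAbs K 2) ^ 2 : ℝ≥0)) : ℝ≥0∞) ^ r with hCst
  have hCt : Cst ≠ ∞ := ENNReal.rpow_ne_top_of_nonneg hr ENNReal.coe_ne_top
  have hbound : ∀ Y ∈ (Λ k : Set 𝔲),
      (((normAbs K (z • cayley (X₀ + ((LS Y : 𝔲) : Matrix (Fin 2) (Fin 2) K))).charpoly.discr *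
        (normAbs K (z • cayley (X₀ + ((LS Y : 𝔲) : Matrix (Fin 2) (Fin 2) K))).det)⁻¹ : ℝ≥0) : ℝ≥0∞)) ^ (-r) ≤ Cst * ηι (T Y) := by
    intro Y hY
    obtain ⟨hm', hp'⟩ := hgoodk Y hY
    rw [weylRatio_rpow_neg_smul_cayley_eq h2 hz0 hm' hp' r]
    have hTY : ((T Y : 𝔲) : Matrix (Fin 2) (Fin 2) K) = X₀ + ((LS Y : 𝔲) : Matrix (Fin 2) (Fin 2) K) := by rw [hT]; simp
    rw [hηι]; dsimp only; rw [hTY]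
    refine mul_le_mul_of_nonneg_right ?_ zero_le
    rw [hCst]
    refine ENNReal.rpow_le_rpow (ENNReal.coe_le_coe.2 ?_) hr
    exact div_le_div_of_nonneg_right (hB ⟨Y, hY, rfl⟩) zero_le
  -- integrate the bound
  have hstep1 : ∫⁻ Y in (Λ k : Set 𝔲),
      (((normAbs K (z • cayley (X₀ + ((LS Y : 𝔲) : Matrix (Fin 2) (Fin 2) K))).charpoly.discr *
        (normAbs K (z • cayley (X₀ + ((LS Y : 𝔲) : Matrix (Fin 2) (Fin 2) K))).det)⁻¹ : ℝ≥0) : ℝ≥0∞)) ^ (-r) ∂μ ≤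
      Cst * ∫⁻ Y in (Λ k : Set 𝔲), ηι (T Y) ∂μ := by
    rw [← lintegral_const_mul' _ _ hCt]
    exact setLIntegral_mono' (hΛo k).measurableSet fun Y hY => hbound Y hY
  -- change of variables `Y ↦ T Y = X₀ + L̃ Y`: `μ.map T = (addEquivAddHaarChar L̃)⁻¹ • μ`
  have hstep2 : ∫⁻ Y in (Λ k : Set 𝔲), ηι (T Y) ∂μ ≤ ((addEquivAddHaarChar LS)⁻¹ : ℝ≥0) * ∫⁻ X in V, ηι X ∂μ := by
    have hTm : Measurable T := hTc.measurable
    let e : 𝔲 ≃ᵐ 𝔲 := (LS.toHomeomorph.trans (Homeomorph.addLeft (⟨X₀, hX₀⟩ : 𝔲))).toMeasurableEquiv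
    have he : (e : 𝔲 → 𝔲) = T := by
      funext Y; rw [hT]; rfl
    have hmapLS : μ.map LS = ((addEquivAddHaarChar LS)⁻¹ : ℝ≥0) • μ := by
      have h := addEquivAddHaarChar_smul_map μ LS
      rw [← h, smul_smul, inv_mul_cancel₀ (addEquivAddHaarChar_pos LS).ne', one_smul, h]
    have hmapT : μ.map T = ((addEquivAddHaarChar LS)⁻¹ : ℝ≥0) • μ := by
      have : T = (fun Y : 𝔲 => (⟨X₀, hX₀⟩ : 𝔲) + Y) ∘ LS := by funext Y; rfl
      have hLSm : Measurable (LS : 𝔲 → 𝔲) := LS.continuous.measurable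
      rw [this, ← Measure.map_map (measurable_const_add _) hLSm]
      change Measure.map (fun Y : 𝔲 => (⟨X₀, hX₀⟩ : 𝔲) + Y) (μ.map LS) = _
      rw [hmapLS, Measure.map_smul, map_add_left_eq_self]
    calc ∫⁻ Y in (Λ k : Set 𝔲), ηι (T Y) ∂μ ≤ ∫⁻ Y in T ⁻¹' V, ηι (T Y) ∂μ := lintegral_mono_set hΛkV
      _ = ∫⁻ X in V, ηι X ∂(μ.map T) := by
          rw [← he, MeasurableEquiv.restrict_map, lintegral_map_equiv]
      _ = ((addEquivAddHaarChar LS)⁻¹ : ℝ≥0) * ∫⁻ X in V, ηι X ∂μ := by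
          rw [hmapT, Measure.restrict_smul, lintegral_smul_measure, ENNReal.smul_def, smul_eq_mul]
  have hfinV : ∫⁻ X in V, ηι X ∂μ < ∞ := lt_of_le_of_lt (lintegral_mono_set hVU) hint
  refine ENNReal.mul_lt_top (lt_top_iff_ne_top.2 hκt) ?_
  refine lt_of_le_of_lt hstep1 (ENNReal.mul_lt_top (lt_top_iff_ne_top.2 hCt) ?_)
  exact lt_of_le_of_lt hstep2 (ENNReal.mul_lt_top ENNReal.coe_lt_top hfinV)

end Head

end Summit.HodgeConjecture.HodgeConjecture.Cruxes.H413.K2E3U11WeylDiscrGroupToLieRpow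

end
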